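import Mathlib.NumberTheory.NumberField.House
import HarnessLib

/-!
# Siegel's lemma over the integers of a number field, with an explicit constant symbol

Topic: `Literature/NumberTheory/Transcendental`. Mathlib's
`NumberField.house.exists_ne_zero_int_vec_house_le` (Siegel's lemma over `𝓞 K` through the house)
states its bound with a constant private to that file. For the parameter bookkeeping of Baker's
method (plan item W4/S4 of the unit `provefact-Literature.NumberTheory.Transcendental.H-b596640137`)
we repackage it (PROVED, a thin wrapper): there is a constant `C_K ≥ 1` depending only on the
number field `K` such that every non-trivial underdetermined system `a ξ = 0` of `p` equations in
`q > p` unknowns with coefficients in `𝓞 K` of house `≤ A` (`A ≥ 1`) has a non-zero solution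
`ξ ∈ 𝓞 K^q` with `house ξ_l ≤ C_K (C_K q A)^{p/(q-p)}` (`siegel_house`); the degenerate case
`a = 0` is included (any unit vector), which is why `A, C_K ≥ 1` are imposed.

## References

* A. Baker, G. Wüstholz, *Logarithmic Forms and Diophantine Geometry*, CUP 2007, §6.8 (Siegel's
  lemma in the construction of the auxiliary function).
* Mathlib, `Mathlib/NumberTheory/NumberField/House.lean`.
-/

noncomputable section

open NumberField

namespace Literature.NumberTheory.Transcendental

/-- Raw form: the Mathlib statement with its (unnamed) constant existentially quantified.
[folklore] -/
theorem exists_siegel_const_raw (K : Type) [Field K] [NumberField K] :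
    ∃ C : ℝ, ∀ (α β : Type) (iα : Fintype α) (iβ : Fintype β)
      (a : Matrix α β (𝓞 K)), a ≠ 0 → ∀ (p q : ℕ), 0 < p → p < q →
      @Fintype.card α iα = p → @Fintype.card β iβ = q → ∀ (A : ℝ),
      (∀ k l, house (algebraMap (𝓞 K) K (a k l)) ≤ A) →
      ∃ ξ : β → 𝓞 K, ξ ≠ 0 ∧ a.mulVec ξ = 0 ∧
        ∀ l, house ((ξ l : 𝓞 K) : K) ≤ C * (C * q * A) ^ ((p : ℝ) / (q - p)) :=
  ⟨_, fun α β iα iβ a ha p q h0p hpq cardα cardβ A habs =>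
    @NumberField.house.exists_ne_zero_int_vec_house_le K _ _ α β a ha p q h0p hpq iβ cardβ A habs
      (Classical.decEq _) iα cardα⟩

/-- **Siegel's constant** of the number field `K` (`≥ 1`). [folklore] -/
def siegelConst (K : Type) [Field K] [NumberField K] : ℝ :=
  max 1 |(exists_siegel_const_raw K).choose|

/-- `1 ≤ C_K`. [folklore] -/
theorem one_le_siegelConst (K : Type) [Field K] [NumberField K] : 1 ≤ siegelConst K := le_max_left _ _

/-- **Siegel's lemma over `𝓞 K` (house form, degenerate case included).** For `p < q`, `0 < p`,
a matrix `a ∈ 𝓞 K^{p×q}` with `house(a_{kl}) ≤ A`, `A ≥ 1`: there is `ξ ∈ 𝓞 K^q`, `ξ ≠ 0`,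
`a ξ = 0`, `house ξ_l ≤ C_K (C_K q A)^{p/(q-p)}`. [cite: BakerWustholz2007, §6.8] -/
theorem siegel_house (K : Type) [Field K] [NumberField K] {α β : Type} [Fintype α] [Fintype β]
    [Nonempty β] (a : Matrix α β (𝓞 K)) {p q : ℕ} (h0p : 0 < p) (hpq : p < q)
    (cardα : Fintype.card α = p) (cardβ : Fintype.card β = q) {A : ℝ} (hA : 1 ≤ A)
    (habs : ∀ k l, house (algebraMap (𝓞 K) K (a k l)) ≤ A) :
    ∃ ξ : β → 𝓞 K, ξ ≠ 0 ∧ a.mulVec ξ = 0 ∧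
      ∀ l, house ((ξ l : 𝓞 K) : K) ≤ siegelConst K * (siegelConst K * q * A) ^ ((p : ℝ) / (q - p)) := by
  classical
  set C := siegelConst K with hC
  have hC1 : 1 ≤ C := one_le_siegelConst K
  have hq0 : (0 : ℝ) < q := by exact_mod_cast h0p.trans hpq
  have hexp : 0 ≤ (p : ℝ) / (q - p) := by
    apply div_nonneg (Nat.cast_nonneg p)
    have : (p : ℝ) < q := by exact_mod_cast hpq
    linarith
  have hbase : 1 ≤ C * q * A := by
    have hq1 : (1 : ℝ) ≤ q := by exact_mod_cast h0p.trans hpq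
    nlinarith [mul_le_mul hC1 hq1 zero_le_one (zero_le_one.trans hC1)]
  have hbound1 : 1 ≤ C * (C * q * A) ^ ((p : ℝ) / (q - p)) :=
    one_le_mul_of_one_le_of_one_le hC1 (Real.one_le_rpow hbase hexp)
  by_cases ha : a = 0
  · -- degenerate system: a unit vector
    obtain ⟨l₀⟩ := ‹Nonempty β›
    refine ⟨Pi.single l₀ 1, ?_, by rw [ha, Matrix.zero_mulVec], fun l => ?_⟩
    · intro h
      have := congrFun h l₀
      simp at this
    · by_cases hl : l = l₀
      · subst hl
        have h1 : house (1 : K) = 1 := by simp [house]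
        simpa [h1] using hbound1
      · have h0 : (Pi.single l₀ (1 : 𝓞 K) : β → 𝓞 K) l = 0 := Pi.single_eq_of_ne hl _
        rw [h0]
        have : house ((0 : 𝓞 K) : K) = 0 := by simp [house]
        rw [this]
        exact zero_le_one.trans hbound1
  · have C₀spec := (exists_siegel_const_raw K).choose_spec
    obtain ⟨ξ, hξ, hmul, hle⟩ := C₀spec α β inferInstance inferInstance a ha p q h0p hpq cardα cardβ A habs
    refine ⟨ξ, hξ, hmul, fun l => (hle l).trans ?_⟩
    -- `|C₀ (C₀ q A)^e| ≤ C (C q A)^e` with `C = max 1 |C₀|`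
    set C₀ := (exists_siegel_const_raw K).choose
    have hC0 : |C₀| ≤ C := le_max_right _ _
    have hA0 : 0 ≤ A := zero_le_one.trans hA
    have hqA : 0 ≤ (q : ℝ) * A := mul_nonneg hq0.le hA0
    calc C₀ * (C₀ * q * A) ^ ((p : ℝ) / (q - p))
        ≤ |C₀ * (C₀ * q * A) ^ ((p : ℝ) / (q - p))| := le_abs_self _
      _ = |C₀| * |(C₀ * q * A) ^ ((p : ℝ) / (q - p))| := abs_mul _ _
      _ ≤ |C₀| * (|C₀| * q * A) ^ ((p : ℝ) / (q - p)) := by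
          refine mul_le_mul_of_nonneg_left ?_ (abs_nonneg _)
          refine (Real.abs_rpow_le_abs_rpow _ _).trans ?_
          rw [show |C₀ * q * A| = |C₀| * q * A by
            rw [abs_mul, abs_mul, abs_of_nonneg hq0.le, abs_of_nonneg hA0]]
      _ ≤ C * (C * q * A) ^ ((p : ℝ) / (q - p)) := by
          refine mul_le_mul hC0 ?_ (Real.rpow_nonneg (by positivity) _) (zero_le_one.trans hC1)
          refine Real.rpow_le_rpow (by positivity) ?_ hexp
          have : |C₀| * (q * A) ≤ C * (q * A) := mul_le_mul_of_nonneg_right hC0 hqA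
          nlinarith [this]

end Literature.NumberTheory.Transcendental

end
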